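import Summits.SmoothPoincare4.SmoothPoincare4.Theorems.SullivanDualTargetStubCutoff
import Literature.Geometry.Kaehler.ChartTransport
import Literature.Geometry.Kaehler.OpensExtendReal
import Literature.Geometry.Kaehler.ManifoldFormsFunSmulProofs
import Literature.Geometry.Symplectic.TamingWitness

/-!
# SmoothPoincare4 / SullivanDual — crux `Target` (stmt-SmoothPoincare4-7823), stub `helper_primitiveOnPuncturedBall`

Transport between the punctured manifold `M ∖ {p}` (the open submanifold `punctured p`) and
the ambient manifold `M` of the de Rham input "closed `2`-forms on the punctured chart-ball are
exact": given a smooth closed `2`-form `sf` on `M ∖ {p}` and the Poincaré statement for the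
chart set `W = chartSet (𝓡 4) p (ball (e p) r ∖ {e p})` (`e = extChartAt (𝓡 4) p`) in the
language of local forms on `M` (hypothesis `hPL`), we produce a smooth `1`-form `γ` on `M ∖ {p}`
with `dγ = sf` on the punctured chart-ball of a smaller radius `r' < r`.

Proof.  Extend `sf` by zero to `ŝf = sf.extendOpensReal w₀` on `M`; its restriction to `W` is a
closed local form on `W` (smooth at the points of `W ⊆ M ∖ {p}`, and `dŝf = d sf = 0` there, read
through the inclusion `M ∖ {p} → M`), hence `hPL` gives a local primitive `β` on `W`,
`dβ = ŝf` on `W`.  Pull `β` back to `M ∖ {p}` (`γ₁`) and cut off: with `r' < r'' < r` and a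
smooth `φ` vanishing on the punctured `r'`-ball and equal to `1` near every point off the
punctured `r''`-ball (`SullivanDual.stub_cutoff`), `γ = (1 - φ) γ₁` is smooth everywhere
(`γ₁` is smooth at the points over `W`, and `γ = 0` near the other points) and `dγ = dγ₁ = sf`
on the punctured `r'`-ball. [folklore]

References: F. W. Warner, GTM 94 (1983), 2.22–2.23, 4.18 [WarnerGTM94]; R. Bott, L. W. Tu,
*Differential Forms in Algebraic Topology* (1982), §I.1 [BottTu1982Forms].
-/

noncomputable section

-- the registered namespace `Summit.SmoothPoincare4.SmoothPoincare4.Theorems` repeats a component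
set_option linter.dupNamespace false

open scoped Manifold ContDiff Topology
open Set Filter Metric
open Literature.Geometry.Kaehler Literature.Geometry.Symplectic

namespace Summit.SmoothPoincare4.SmoothPoincare4.Theorems

namespace SullivanDual

/-- **Primitive of a closed `2`-form on a punctured chart-ball.**  Let `sf` be a smooth closed
`2`-form on `M ∖ {p}` and suppose that on the chart set
`W = chartSet (𝓡 4) p (ball (e p) r ∖ {e p})` every closed local `2`-form is exact (`hPL`, the
Poincaré lemma for the punctured chart `4`-ball).  Then for `0 < r' < r` there is a smooth
`1`-form `γ` on `M ∖ {p}` with `dγ = sf` at every point of the punctured chart-ball of radius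
`r'`.  (Extend `sf` by zero to `M`, take a local primitive on `W`, pull it back to `M ∖ {p}`
and cut it off between the radii `r'` and `r`.) [folklore] -/
theorem helper_primitiveOnPuncturedBall
    {M : Type*} [TopologicalSpace M] [T2Space M] [SecondCountableTopology M]
    [ChartedSpace (EuclideanSpace ℝ (Fin 4)) M] [IsManifold (𝓡 4) ∞ M]
    (p : M) {r r' : ℝ} (hr' : 0 < r') (hr'r : r' < r)
    (hball : Metric.ball (extChartAt (𝓡 4) p p) r ⊆ (extChartAt (𝓡 4) p).target)
    (hPL : ∀ hW : IsOpen (chartSet (𝓡 4) p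
        (Metric.ball (extChartAt (𝓡 4) p p) r \ {extChartAt (𝓡 4) p p})),
      localClosedForms (𝓡 4) ℝ 2
          (chartSet (𝓡 4) p (Metric.ball (extChartAt (𝓡 4) p p) r \ {extChartAt (𝓡 4) p p})) ≤
        localExactForms (𝓡 4) ℝ hW 2)
    (sf : MForm (𝓡 4) (punctured p) ℝ 2) (hsf : IsSmoothForm sf) (hsfc : IsClosedForm sf) :
    ∃ γ : MForm (𝓡 4) (punctured p) ℝ 1, IsSmoothForm γ ∧
      ∀ x : punctured p, InPuncturedChartBall p r' x → mextDeriv γ x = sf x := by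
  classical
  set e := extChartAt (𝓡 4) p with he
  set W : Set M := chartSet (𝓡 4) p (ball (e p) r \ {e p}) with hW_def
  have hW : IsOpen W := isOpen_chartSet (𝓡 4) p (isOpen_ball.sdiff isClosed_singleton)
  -- points of `W` are not `p`, hence lie in the punctured manifold
  have hWU : ∀ x ∈ W, x ∈ punctured p := by
    intro x hx
    rw [mem_punctured]
    rintro rfl
    exact (mem_chartSet_iff.1 hx).2.2 rfl
  -- points of the punctured chart-ball of radius `s ≤ r` lie over `W`
  have hIn : ∀ {s : ℝ}, s ≤ r → ∀ x : punctured p, InPuncturedChartBall p s x → x.1 ∈ W := by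
    intro s hs x hx
    have hxs : x.1 ∈ e.source := by rw [he, extChartAt_source]; exact hx.1
    refine mem_chartSet_iff.2 ⟨hxs, ball_subset_ball hs hx.2, ?_⟩
    intro hxe
    have hxp : x.1 ≠ p := mem_punctured.1 x.2
    exact hxp (e.injOn hxs (mem_extChartAt_source (I := 𝓡 4) p) hxe)
  rcases isEmpty_or_nonempty (punctured p) with hE | ⟨⟨w₀⟩⟩
  · exact ⟨0, isSmoothForm_zero, fun x => isEmptyElim x⟩
  -- (1) extend `sf` by zero to `M`
  set sfh : MForm (𝓡 4) M ℝ 2 := sf.extendOpensReal w₀ with hsfh_def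
  have hsfh_s : ∀ x ∈ W, sfh.SmoothAt x := fun x hx =>
    MForm.smoothAt_extendOpensReal (hWU x hx) (hsf ⟨x, hWU x hx⟩)
  have hsfh_back : sfh.pullback (𝓡 4) (Subtype.val : punctured p → M) = sf :=
    MForm.pullback_subtypeVal_extendOpensReal sf
  -- (2) its restriction to `W` is a closed local form on `W`
  have hmem : sfh.restr W ∈ localClosedForms (𝓡 4) ℝ 2 W := by
    refine ⟨⟨fun x hx => (MForm.smoothAt_restr_iff hW _ hx).2 (hsfh_s x hx),
      fun x hx => MForm.restr_apply_of_notMem _ hx⟩, fun x hx => ?_⟩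
    rw [mextDeriv_restr_apply hW _ hx]
    ext v
    have h1 := mextDeriv_pullback_subtypeVal_apply (I := 𝓡 4) (β := sfh)
      (x := (⟨x, hWU x hx⟩ : punctured p)) (hsfh_s x hx) v
    rw [hsfh_back] at h1
    rw [← h1, show mextDeriv sf = 0 from hsfc]
    rfl
  -- (3) a local primitive on `W`
  obtain ⟨β, hβ⟩ := (mem_localExactForms_succ_iff hW).1 (hPL hW hmem)
  have hdβ : ∀ x (hx : x ∈ W) (v : Fin 2 → EuclideanSpace ℝ (Fin 4)),
      mextDeriv (β : MForm (𝓡 4) M ℝ 1) x v = sf ⟨x, hWU x hx⟩ v := by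
    intro x hx v
    rw [← localD_apply_of_mem hW β hx, hβ, MForm.restr_apply_of_mem _ hx]
    have h2 := MForm.pullback_subtypeVal_apply (I := 𝓡 4) sfh (⟨x, hWU x hx⟩ : punctured p) v
    rw [hsfh_back] at h2
    exact h2.symm
  -- (4) back to the punctured manifold, and cut off
  set γ₁ : MForm (𝓡 4) (punctured p) ℝ 1 :=
    (β : MForm (𝓡 4) M ℝ 1).pullback (𝓡 4) (Subtype.val : punctured p → M) with hγ₁_def
  have hγ₁s : ∀ x : punctured p, x.1 ∈ W → γ₁.SmoothAt x := fun x hx =>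
    MForm.SmoothAt.pullback_subtypeVal (β.2.1 x.1 hx)
  obtain ⟨r'', hr'', hr''r⟩ := exists_between hr'r
  have hball'' : closedBall (e p) r'' ⊆ e.target := (closedBall_subset_ball hr''r).trans hball
  obtain ⟨φ, hφs, hφ0, hφ1, -⟩ := stub_cutoff p r' r'' hr' hr'' hball''
  have hφs' : ContMDiff (𝓡 4) 𝓘(ℝ, ℝ) ∞ (fun x => 1 - φ x) := contMDiff_const.sub hφs
  refine ⟨(fun x => 1 - φ x) • γ₁, ?_, ?_⟩
  · -- smoothness
    intro x
    by_cases hx : x.1 ∈ W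
    · exact MForm.SmoothAt.fun_smul (hφs' x) (hγ₁s x hx)
    · have hx' : ¬ InPuncturedChartBall p r'' x := fun h => hx (hIn hr''r.le x h)
      refine MForm.smoothAt_of_eventuallyEq_zero ?_
      filter_upwards [hφ1 x hx'] with z hz
      simp only [Pi.smul_apply', hz, sub_self, zero_smul]
  · -- the derivative on the punctured `r'`-ball
    intro x hx
    have hxW : x.1 ∈ W := hIn hr'r.le x hx
    have hev : ∀ᶠ z in 𝓝 x, ((fun x => 1 - φ x) • γ₁) z = γ₁ z := by
      filter_upwards [(isOpen_setOf_inPuncturedChartBall p r').mem_nhds hx] with z hz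
      simp only [Pi.smul_apply', hφ0 z hz, sub_zero, one_smul]
    rw [mextDeriv_congr_of_eventuallyEq hev]
    ext v
    rw [hγ₁_def, mextDeriv_pullback_subtypeVal_apply (β.2.1 x.1 hxW), hdβ x.1 hxW v]

end SullivanDual

end Summit.SmoothPoincare4.SmoothPoincare4.Theorems

end
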